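/-
Copyright: statement-level skeleton of a published paper (lit-balaban cell, Phase-2 proof seat p19, gen 2). No claims beyond
what the kernel checks below.
-/
import Mathlib
import Literature.MathematicalPhysics.QuantumFieldTheory.Balaban1983to89.B3Sect2FirstEstimate
import Literature.MathematicalPhysics.QuantumFieldTheory.Balaban1983to89.B3Ineq215Proof

/-!
# B3 — T. Bałaban, *(Higgs)₂,₃ quantum fields in a finite volume. III. Renormalization*, CMP **88** (1983) 411–445
[Balaban1983Higgs3] — (2.15) p. 427 on the typed carrier `B3Sect2FirstEstimate.ScaledGraph`: the MODEL INSTANCE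

statement-level skeleton of published theorems with citation tags; proofs where landed; nothing here is a claim about
the Yang–Mills mass gap

PDF held: `paper:balaban1983-higgs-2-3-quantum-fields-finite-volume` (journal page = PDF page + 410); renders
`pub-balaban/b2b-balaban-ref1/pages/1983-cmp88-higgs23-III/1983-cmp88-higgs23-III-p016, p017-x2.png` (pp. 426, 427).

KNITTING for SKELETON rows **B3.Eq2.13-2.14 / B3.Eq2.15-2.16** (unit `lit-balaban-p19` gen 2; HOME
`run/shared/lean/pub/lit-balaban/`).  r15 typed (2.14) as `ScaledGraph.Etilde` and (2.15) as `Ineq215 G C J :=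
Σ_{j∈J} G.Etilde j ≤ C` (`B3Sect2FirstEstimate`, p243824); `B3Ineq215Proof` proves (2.15) for the concrete multiscale
cubes in Prop. 2.2 generality (`Model.ineq215`).  Here the two are connected: from per-vertex/per-line COUNT data as in
(2.14) (`Counts`: differentiations of `v` acting on `l`, averaged vector legs, the *"proper power"* of each vertex, lines
listed in the order l̃) we build BOTH the `Model` of `B3Ineq215Quotient` (line dimension `a_l = Σ_v [−(d−2)/2·(legs of l
in v) − (differentiations of v on l) + (averaged vector legs of l in v)]`, vertex power `e_v = etaPow v`, `δ₀ = ½δ₁`) and,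
for each scale assignment `j`, r15's carrier `ScaledGraph` on the concrete cubes with the localization family
`{Δ(v)}`, `|Δ(v)| = (L^{j(v)}η)^d`, `Δ(v) ⊂ □(v)` — and PROVE that r15's (2.14) weight sum IS ours:
`(toScaledGraph k j □).Etilde j = toModel.W 0 k j □` (`Etilde_eq_W`).  Consequently (2.15) holds on r15's carrier in
the form `Σ_{j ∈ J(l̃)} (toScaledGraph k j □).Etilde j ≤ const215` (`sum_Etilde_le`) and, per assignment, `Ineq215
(toScaledGraph k j □) const215 {j}` (`ineq215_instance`).  TYPING NOTE (for the owner r15, not a refutation): the field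
`ScaledGraph.locs` is independent of `j`, while in (2.14)–(2.15) *"We localize further the expression to cubes Δ(v) of the
size L^{j(v)}η"* (p. 426) makes the admissible localizations depend on `j`; hence the carrier is instantiated once per
assignment and the printed sum over `j ∈ J(l̃)` is expressed through the family `j ↦ toScaledGraph k j □`.
-/

open Finset

namespace Literature.MathematicalPhysics.QuantumFieldTheory.Balaban1983to89.B3Ineq215

open B3Sect2FirstEstimate

/-- The count data of (2.14) p. 427 for a connected graph with lines listed in the order l̃ = (l(1), …, l(m)): endpoints,
*"every vertex is an endpoint of some line"* (p. 415), the numbers of differentiations of `v` acting on `l`, of legs of `l`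
that are averaged vector legs of `v` ((1.14)/(1.15)), the *"proper power of L^{j(v)}η"* of `v`, and `d`, `L`, `δ₁`.
[cite: Balaban1983Higgs3, (2.14) p.427] -/
structure Counts (V : Type) [Fintype V] [DecidableEq V] (m : ℕ) where
  /-- first endpoint of l(i+1) -/
  src : Fin m → V
  /-- second endpoint of l(i+1) -/
  tgt : Fin m → V
  /-- every vertex lies on a line -/
  touches : ∀ v : V, ∃ l : Fin m, src l = v ∨ tgt l = v
  /-- differentiations of `v` acting on `l` -/
  diffOn : V → Fin m → ℕ
  /-- legs of `l` that are averaged vector legs of `v` -/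
  vecLegAvg : V → Fin m → ℕ
  /-- the proper power of `L^{j(v)}η` of `v` -/
  etaPow : V → ℕ
  /-- dimension -/
  d : ℕ
  /-- block size -/
  L : ℕ
  /-- the decay rate δ₁ of (2.10) -/
  δ₁ : ℝ
  d_pos : 0 < d
  two_le_L : 2 ≤ L
  δ₁_pos : 0 < δ₁

namespace Counts

variable {V : Type} [Fintype V] [DecidableEq V] {m : ℕ} (C : Counts V m)

/-- Number of legs of `l` in `v` (0, 1, 2). [cite: Balaban1983Higgs3, (2.14) p.427] -/
def legsOn (v : V) (l : Fin m) : ℕ := (if C.src l = v then 1 else 0) + (if C.tgt l = v then 1 else 0)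

/-- The exponent of `L^{j_l}η` contributed by the vertex `v` to the line `l` in (2.14): `−(d−2)/2` per leg, `−1` per
differentiation, `+1` per averaged vector leg. [cite: Balaban1983Higgs3, (2.14) p.427] -/
noncomputable def legExp (v : V) (l : Fin m) : ℝ :=
  -(((C.d : ℝ) - 2) / 2) * (C.legsOn v l : ℝ) - (C.diffOn v l : ℝ) + (C.vecLegAvg v l : ℝ)

/-- The total dimension `a_l` of the line `l` (Prop. 2.2: *"lines … with arbitrary dimensions instead of −d+2"*).
[cite: Balaban1983Higgs3, Prop. 2.2 p.428] -/
noncomputable def lineDim (l : Fin m) : ℝ := ∑ v, C.legExp v l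

/-- The generalized graph of `B3Ineq215Quotient` determined by the counts. [cite: Balaban1983Higgs3, Prop. 2.2 p.428] -/
noncomputable def toModel : Model V m where
  src := C.src
  tgt := C.tgt
  e := fun v => (C.etaPow v : ℝ)
  a := C.lineDim
  d := C.d
  L := C.L
  δ₀ := C.δ₁ / 2
  d_pos := C.d_pos
  two_le_L := C.two_le_L
  δ₀_pos := half_pos C.δ₁_pos

/-- r15's carrier of (2.14) on the concrete cubes, for the scale assignment `j`: localizations `Δ(v) ⊂ □(v)` of size
`L^{j(v)}η`, `dist = η · distI` (η-units), `η = L^{−k}`. [cite: Balaban1983Higgs3, (2.14) p.427] -/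
noncomputable abbrev toScaledGraph (k : ℕ) (j : Fin m → ℕ) (box : V → Fin C.d → ℕ) : ScaledGraph where
  V := V
  Ln := Fin m
  instFintypeV := inferInstance
  instFintypeLn := inferInstance
  instDecEqV := inferInstance
  src := C.src
  tgt := C.tgt
  touches := C.touches
  diffOn := C.diffOn
  vecLegAvg := C.vecLegAvg
  etaPow := C.etaPow
  Cube := Cube C.d
  dist := fun A B => ((C.L : ℝ) ^ k)⁻¹ * (Cube.distI C.L A B : ℝ)
  locs := C.toModel.Locs 0 k j box
  L := C.L
  η := ((C.L : ℝ) ^ k)⁻¹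
  d := C.d
  δ₁ := C.δ₁
  one_lt_L := by exact_mod_cast lt_of_lt_of_le one_lt_two C.two_le_L
  η_pos := by have : (0 : ℝ) < C.L := by exact_mod_cast lt_of_lt_of_le two_pos C.two_le_L
              positivity

/-- The scales agree: r15's `scale t = L^tη` is `Model.sc k t`. [cite: Balaban1983Higgs3, (2.10) p.426] -/
theorem scale_eq (k : ℕ) (j : Fin m → ℕ) (box : V → Fin C.d → ℕ) (t : ℕ) :
    (C.toScaledGraph k j box).scale t = C.toModel.sc k t := rfl

/-- At stage `0` every vertex is its own block and `j(v)` is the printed lowest index (all `j_l ≤ k − 1`).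
[cite: Balaban1983Higgs3, (2.14) p.426] -/
theorem lowestIndex_eq (k : ℕ) {j : Fin m → ℕ} (hjk : ∀ l, j l < k) (box : V → Fin C.d → ℕ) (v : V) :
    (C.toScaledGraph k j box).lowestIndex j v = C.toModel.low 0 v j k := by
  have hmem : ∀ l : Fin m, l ∈ (C.toScaledGraph k j box).linesAt v ↔ l ∈ C.toModel.remAt 0 v := by
    intro l; simp [ScaledGraph.linesAt, Model.mem_remAt, toModel]
  apply le_antisymm
  · -- lowestIndex ≤ low: low is k or some j l with l at v
    have hcases : C.toModel.low 0 v j k ∈ insert k ((C.toModel.remAt 0 v).image j) := Finset.min'_mem _ _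
    rcases Finset.mem_insert.1 hcases with hk | himg
    · obtain ⟨l, hl⟩ := C.touches v
      rw [hk]
      exact ((C.toScaledGraph k j box).lowestIndex_le j (v := v) (l := l) hl).trans (hjk l).le
    · obtain ⟨l, hl, e⟩ := Finset.mem_image.1 himg
      rw [← e]
      have hl' : C.src l = v ∨ C.tgt l = v := by simpa [Model.mem_remAt, toModel] using hl
      exact (C.toScaledGraph k j box).lowestIndex_le j (v := v) (l := l) hl'
  · -- low ≤ lowestIndex = j l₀ for some line l₀ at v
    obtain ⟨l₀, hl₀, e⟩ := Finset.exists_mem_eq_inf' ((C.toScaledGraph k j box).linesAt_nonempty v) j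
    unfold ScaledGraph.lowestIndex
    rw [e]
    exact C.toModel.low_le_of_mem j k ((hmem l₀).1 hl₀)

/-- The exponential factors agree: r15's `lineFactor` at `δ₁` is ours at stage `0` (`δ₀ = ½δ₁`, η cancels).
[cite: Balaban1983Higgs3, (2.14) p.427] -/
theorem lineFactor_eq (k : ℕ) (j : Fin m → ℕ) (box : V → Fin C.d → ℕ) (Θ : V → Cube C.d) (l : Fin m) :
    (C.toScaledGraph k j box).lineFactor j Θ l = C.toModel.lineF 0 j Θ l := by
  have hL : (0 : ℝ) < C.L := by exact_mod_cast lt_of_lt_of_le two_pos C.two_le_L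
  unfold ScaledGraph.lineFactor Model.lineF Model.δAt ScaledGraph.scale
  simp only [toModel, Model.rep_zero, pow_zero, div_one]
  congr 1
  field_simp

/-- The vertex factors agree with `VF · LP` at stage `0`: exchanging the products over vertices and lines collects, for
each line, the exponents contributed by its endpoints into `a_l`. [cite: Balaban1983Higgs3, (2.14) p.427] -/
theorem prod_vertexFactor_eq (k : ℕ) {j : Fin m → ℕ} (hjk : ∀ l, j l < k) (box : V → Fin C.d → ℕ) :
    ∏ v, (C.toScaledGraph k j box).vertexFactor j v = C.toModel.VF 0 k j * C.toModel.LP 0 k j := by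
  have hx : ∀ t, 0 < C.toModel.sc k t := fun t => C.toModel.sc_pos k t
  -- every vertex factor = (L^{j(v)}η)^{d + etaPow v} · Π_l (L^{j_l}η)^{legExp v l}
  have hvf : ∀ v : V, (C.toScaledGraph k j box).vertexFactor j v
      = C.toModel.sc k (C.toModel.low 0 v j k) ^ ((C.d : ℝ) + (C.etaPow v : ℝ))
        * ∏ l : Fin m, C.toModel.sc k (j l) ^ C.legExp v l := by
    intro v
    have e1 : ∀ l : Fin m, C.toModel.sc k (j l) ^ (-(((C.d : ℝ) - 2) / 2) * (C.legsOn v l : ℝ))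
        * ((C.toModel.sc k (j l))⁻¹ ^ C.diffOn v l) * C.toModel.sc k (j l) ^ C.vecLegAvg v l
        = C.toModel.sc k (j l) ^ C.legExp v l := by
      intro l
      have hxl := hx (j l)
      unfold legExp
      rw [inv_pow, ← Real.rpow_natCast _ (C.diffOn v l), ← Real.rpow_neg hxl.le, ← Real.rpow_natCast _ (C.vecLegAvg v l),
        ← Real.rpow_add hxl, ← Real.rpow_add hxl]
      congr 1
    have e0 : (C.toScaledGraph k j box).vertexFactor j v
        = C.toModel.sc k (C.toModel.low 0 v j k) ^ C.d
          * (∏ l : Fin m, C.toModel.sc k (j l) ^ (-(((C.d : ℝ) - 2) / 2) * (C.legsOn v l : ℝ)))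
          * (∏ l : Fin m, (C.toModel.sc k (j l))⁻¹ ^ C.diffOn v l)
          * C.toModel.sc k (C.toModel.low 0 v j k) ^ C.etaPow v
          * ∏ l : Fin m, C.toModel.sc k (j l) ^ C.vecLegAvg v l := by
      unfold ScaledGraph.vertexFactor
      rw [C.lowestIndex_eq k hjk box v]
      rfl
    rw [e0]
    calc C.toModel.sc k (C.toModel.low 0 v j k) ^ C.d
          * (∏ l : Fin m, C.toModel.sc k (j l) ^ (-(((C.d : ℝ) - 2) / 2) * (C.legsOn v l : ℝ)))
          * (∏ l : Fin m, (C.toModel.sc k (j l))⁻¹ ^ C.diffOn v l)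
          * C.toModel.sc k (C.toModel.low 0 v j k) ^ C.etaPow v
          * ∏ l : Fin m, C.toModel.sc k (j l) ^ C.vecLegAvg v l
        = (C.toModel.sc k (C.toModel.low 0 v j k) ^ C.d * C.toModel.sc k (C.toModel.low 0 v j k) ^ C.etaPow v)
          * ∏ l : Fin m, (C.toModel.sc k (j l) ^ (-(((C.d : ℝ) - 2) / 2) * (C.legsOn v l : ℝ))
            * ((C.toModel.sc k (j l))⁻¹ ^ C.diffOn v l) * C.toModel.sc k (j l) ^ C.vecLegAvg v l) := by
          rw [Finset.prod_mul_distrib, Finset.prod_mul_distrib]; ring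
      _ = _ := by
          rw [Finset.prod_congr rfl fun l _ => e1 l]
          congr 1
          have hxv := hx (C.toModel.low 0 v j k)
          rw [← Real.rpow_natCast _ C.d, ← Real.rpow_natCast _ (C.etaPow v), ← Real.rpow_add hxv]
  simp_rw [hvf]
  rw [Finset.prod_mul_distrib, Finset.prod_comm]
  congr 1
  · -- VF at stage 0: all vertices are representatives, e = etaPow
    unfold Model.VF
    have hreps : C.toModel.reps 0 = Finset.univ := by ext b; simp [Model.mem_reps]
    rw [hreps]
    refine Finset.prod_congr rfl fun v _ => ?_
    have he : C.toModel.eAt 0 v = (C.etaPow v : ℝ) := by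
      unfold Model.eAt
      rw [if_neg (by simp [Model.Nontriv, Model.before_zero])]
      rfl
    rw [he]
    rfl
  · -- LP at stage 0: Π_v x^{c_v} = x^{Σ_v c_v} = x^{a_l}
    unfold Model.LP
    have hrem : Model.remLines m 0 = Finset.univ := by ext l; simp [Model.mem_remLines]
    rw [hrem]
    refine Finset.prod_congr rfl fun l _ => ?_
    have hxl := hx (j l)
    show ∏ v, C.toModel.sc k (j l) ^ C.legExp v l = C.toModel.sc k (j l) ^ C.lineDim l
    unfold lineDim
    simp_rw [Real.rpow_def_of_pos hxl]
    rw [← Real.exp_sum, Finset.mul_sum]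

/-- **(2.14) on r15's carrier IS the concrete weight sum**: `(toScaledGraph k j □).Etilde j = toModel.W 0 k j □` for every
scale assignment with `j_l ≤ k − 1`. [cite: Balaban1983Higgs3, (2.14) p.427] -/
theorem Etilde_eq_W (k : ℕ) {j : Fin m → ℕ} (hjk : ∀ l, j l < k) (box : V → Fin C.d → ℕ) :
    (C.toScaledGraph k j box).Etilde j = C.toModel.W 0 k j box := by
  unfold ScaledGraph.Etilde ScaledGraph.weight214 Model.W
  refine Finset.sum_congr rfl fun Θ _ => ?_
  rw [C.prod_vertexFactor_eq k hjk box]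
  congr 1
  unfold Model.EXP
  have hrem : Model.remLines m 0 = Finset.univ := by ext l; simp [Model.mem_remLines]
  rw [hrem]
  exact Finset.prod_congr rfl fun l _ => C.lineFactor_eq k j box Θ l

/-- **(2.15)** p. 427 on r15's carrier: `Σ_{j∈J(l̃)} Σ_{{Δ(v)}} Ẽ(G(j), {Δ(v)}) ≤ O(1)` with `O(1) = const215`, under the
hypothesis of p. 426 (every connected component of every `G_i` has positive degree), for every `k` and all unit cubes.
[cite: Balaban1983Higgs3, (2.15) p.427] -/
theorem sum_Etilde_le (hpos : ∀ i, i ≤ m → ∀ b ∈ C.toModel.reps i, C.toModel.Nontriv i b → 0 < C.toModel.D i b)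
    (k : ℕ) (box : V → Fin C.d → ℕ) :
    ∑ j ∈ Model.Mon m k, (C.toScaledGraph k j box).Etilde j ≤ C.toModel.const215 := by
  calc ∑ j ∈ Model.Mon m k, (C.toScaledGraph k j box).Etilde j = ∑ j ∈ Model.Mon m k, C.toModel.W 0 k j box :=
        Finset.sum_congr rfl fun j hj => C.Etilde_eq_W k (Model.mem_Mon.1 hj).2 box
    _ ≤ C.toModel.const215 := C.toModel.ineq215_of_pos hpos k box

/-- The MODEL INSTANCE of the typed row: `Ineq215 (toScaledGraph k j □) const215 {j}` for each `j ∈ J(l̃)` (the carrier's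
`locs` being fixed per assignment, see the typing note in the module docstring). [cite: Balaban1983Higgs3, (2.15) p.427] -/
theorem ineq215_instance (hpos : ∀ i, i ≤ m → ∀ b ∈ C.toModel.reps i, C.toModel.Nontriv i b → 0 < C.toModel.D i b)
    (k : ℕ) (box : V → Fin C.d → ℕ) {j : Fin m → ℕ} (hj : j ∈ Model.Mon m k) :
    Ineq215 (C.toScaledGraph k j box) C.toModel.const215 {j} := by
  unfold Ineq215
  rw [Finset.sum_singleton]
  calc (C.toScaledGraph k j box).Etilde j ≤ ∑ j' ∈ Model.Mon m k, (C.toScaledGraph k j' box).Etilde j' := by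
        refine Finset.single_le_sum (fun j' _ => (C.toScaledGraph k j' box).Etilde_nonneg j') hj
    _ ≤ C.toModel.const215 := C.sum_Etilde_le hpos k box

end Counts

end Literature.MathematicalPhysics.QuantumFieldTheory.Balaban1983to89.B3Ineq215
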